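import Literature.Algebra.Polynomial.CasasAlvero.SmallDegrees
import Mathlib.Tactic.NormNum.Prime
import HarnessLib

/-!
# Casas-Alvero in degree 4: the bad primes are exactly 3, 5, 7 (complete answer over fields)

`SmallDegrees.lean` gives `HoldsInDegree K 4` whenever `char K ∉ {3, 5, 7}` and failure in characteristic 3.  Here the two
remaining characteristics are settled by explicit, prime-field-rational Casas-Alvero quartics found by a 625 + 2401-case search:
* characteristic 5: `X^4 + X^2 = X^2 (X - 2)(X - 3)` — common root `0` with `D^(1)`, `2` with `D^(2) = 6X^2 + 1`, `0` with `D^(3) = 4X`;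
* characteristic 7: `X^4 + X^2 + 2X` (roots 0, 4, 6 in 𝔽₇) — common root `4` with `D^(1)`, `6` with `D^(2)`, `0` with `D^(3)`.
Hence `holdsInDegree_four_iff : HoldsInDegree K 4 ↔ (3 : K) ≠ 0 ∧ (5 : K) ≠ 0 ∧ (7 : K) ≠ 0`: the bad primes for degree 4 are
exactly 3, 5, 7 (De Jong–Draisma, as reported in Castryck–Laterveer–Ounaïes 2012, §1). [cite: CastryckLaterveerOunaies2012, Sec. 1]
-/

noncomputable section

open Polynomial

namespace Literature.Algebra.Polynomial.CasasAlvero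

variable (K : Type*) [Field K]

section Char5
variable [CharP K 5]

/-- `X^4 + X^2` is Casas-Alvero in characteristic 5 (witness roots 0, 2, 0). [cite: CastryckLaterveerOunaies2012, Sec. 1] -/
theorem isCasasAlvero_quartic_char_five : IsCasasAlvero ((X : K[X]) ^ 4 + X ^ 2) := by
  have h5 : (5 : K) = 0 := by simpa using CharP.cast_eq_zero K 5
  have hdeg : ((X : K[X]) ^ 4 + X ^ 2).natDegree = 4 := by
    rw [natDegree_add_eq_left_of_natDegree_lt] <;> simp
  intro i hi0 hi
  rw [hdeg] at hi
  interval_cases i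
  · refine ⟨0, by simp, ?_⟩
    simp only [map_add, hasseDeriv_X_pow, eval_add, eval_mul, eval_C, eval_pow, eval_X]
    norm_num
  · refine ⟨2, ?_, ?_⟩
    · simp only [eval_add, eval_pow, eval_X]
      linear_combination (4 : K) * h5
    · simp only [map_add, hasseDeriv_X_pow, eval_add, eval_mul, eval_C, eval_pow, eval_X,
        show Nat.choose 4 2 = 6 from rfl, show Nat.choose 2 2 = 1 from rfl]
      push_cast
      linear_combination (5 : K) * h5
  · refine ⟨0, by simp, ?_⟩
    simp only [map_add, hasseDeriv_X_pow, eval_add, eval_mul, eval_C, eval_pow, eval_X,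
      show Nat.choose 4 3 = 4 from rfl, show Nat.choose 2 3 = 0 from rfl]
    norm_num

/-- CA₄ FAILS in characteristic 5. [cite: CastryckLaterveerOunaies2012, Sec. 1] -/
theorem not_holdsInDegree_four_of_char_five : ¬ HoldsInDegree K 4 := by
  have h5 : (5 : K) = 0 := by simpa using CharP.cast_eq_zero K 5
  intro h
  have hdeg : ((X : K[X]) ^ 4 + X ^ 2).natDegree = 4 := by
    rw [natDegree_add_eq_left_of_natDegree_lt] <;> simp
  have hmon : ((X : K[X]) ^ 4 + X ^ 2).Monic := by
    apply Monic.add_of_left (monic_X_pow _)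
    rw [degree_X_pow, degree_X_pow]; exact_mod_cast (by norm_num : (2 : ℕ) < 4)
  obtain ⟨a, ha⟩ := h _ hmon hdeg (isCasasAlvero_quartic_char_five K)
  have h0 := congrArg (eval 0) ha
  simp only [eval_add, eval_pow, eval_X, eval_sub, eval_C, zero_sub] at h0
  norm_num at h0
  have ha0 : a = 0 := by
    have := (pow_eq_zero_iff (by norm_num : 4 ≠ 0)).mp h0.symm
    exact neg_eq_zero.mp this
  subst ha0
  have h2 := congrArg (eval 2) ha
  simp only [eval_add, eval_pow, eval_X, map_zero, sub_zero] at h2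
  exact one_ne_zero (by linear_combination (-1 : K) * h2 + h5 : (1 : K) = 0)

end Char5

section Char7
variable [CharP K 7]

/-- `X^4 + X^2 + 2X` is Casas-Alvero in characteristic 7 (witness roots 4, 6, 0). [cite: CastryckLaterveerOunaies2012, Sec. 1] -/
theorem isCasasAlvero_quartic_char_seven : IsCasasAlvero ((X : K[X]) ^ 4 + X ^ 2 + (2 : K) • X ^ 1) := by
  have h7 : (7 : K) = 0 := by simpa using CharP.cast_eq_zero K 7
  have hdeg : ((X : K[X]) ^ 4 + X ^ 2 + (2 : K) • X ^ 1).natDegree = 4 := by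
    have hdeg2 : ((X : K[X]) ^ 4 + X ^ 2).natDegree = 4 := by
      rw [natDegree_add_eq_left_of_natDegree_lt] <;> simp
    have hsm : ((2 : K) • (X : K[X]) ^ 1).natDegree ≤ 1 := (natDegree_smul_le _ _).trans (by simp)
    rw [natDegree_add_eq_left_of_natDegree_lt (by rw [hdeg2]; omega), hdeg2]
  intro i hi0 hi
  rw [hdeg] at hi
  interval_cases i
  · refine ⟨4, ?_, ?_⟩
    · simp only [eval_add, eval_pow, eval_X, eval_smul, smul_eq_mul]
      linear_combination (40 : K) * h7
    · simp only [map_add, map_smul, hasseDeriv_X_pow, eval_add, eval_mul, eval_C, eval_pow, eval_X,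
        eval_smul, smul_eq_mul, show Nat.choose 4 1 = 4 from rfl, show Nat.choose 2 1 = 2 from rfl,
        show Nat.choose 1 1 = 1 from rfl]
      push_cast
      linear_combination (38 : K) * h7
  · refine ⟨6, ?_, ?_⟩
    · simp only [eval_add, eval_pow, eval_X, eval_smul, smul_eq_mul]
      linear_combination (192 : K) * h7
    · simp only [map_add, map_smul, hasseDeriv_X_pow, eval_add, eval_mul, eval_C, eval_pow, eval_X,
        eval_smul, smul_eq_mul, show Nat.choose 4 2 = 6 from rfl, show Nat.choose 2 2 = 1 from rfl,
        show Nat.choose 1 2 = 0 from rfl]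
      push_cast
      linear_combination (31 : K) * h7
  · refine ⟨0, ?_, ?_⟩
    · simp
    · simp only [map_add, map_smul, hasseDeriv_X_pow, eval_add, eval_mul, eval_C, eval_pow, eval_X,
        eval_smul, smul_eq_mul, show Nat.choose 4 3 = 4 from rfl, show Nat.choose 2 3 = 0 from rfl,
        show Nat.choose 1 3 = 0 from rfl]
      norm_num

/-- CA₄ FAILS in characteristic 7. [cite: CastryckLaterveerOunaies2012, Sec. 1] -/
theorem not_holdsInDegree_four_of_char_seven : ¬ HoldsInDegree K 4 := by
  have h7 : (7 : K) = 0 := by simpa using CharP.cast_eq_zero K 7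
  intro h
  have hdeg : ((X : K[X]) ^ 4 + X ^ 2 + (2 : K) • X ^ 1).natDegree = 4 := by
    have hdeg2 : ((X : K[X]) ^ 4 + X ^ 2).natDegree = 4 := by
      rw [natDegree_add_eq_left_of_natDegree_lt] <;> simp
    have hsm : ((2 : K) • (X : K[X]) ^ 1).natDegree ≤ 1 := (natDegree_smul_le _ _).trans (by simp)
    rw [natDegree_add_eq_left_of_natDegree_lt (by rw [hdeg2]; omega), hdeg2]
  have hdeg2 : ((X : K[X]) ^ 4 + X ^ 2).natDegree = 4 := by
    rw [natDegree_add_eq_left_of_natDegree_lt] <;> simp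
  have hmon2 : ((X : K[X]) ^ 4 + X ^ 2).Monic := by
    apply Monic.add_of_left (monic_X_pow _)
    rw [degree_X_pow, degree_X_pow]; exact_mod_cast (by norm_num : (2 : ℕ) < 4)
  have hmon : ((X : K[X]) ^ 4 + X ^ 2 + (2 : K) • X ^ 1).Monic := by
    apply hmon2.add_of_left
    refine lt_of_le_of_lt (degree_smul_le _ _) ?_
    rw [degree_X_pow, degree_eq_natDegree hmon2.ne_zero, hdeg2]
    exact_mod_cast (by norm_num : (1 : ℕ) < 4)
  obtain ⟨a, ha⟩ := h _ hmon hdeg (isCasasAlvero_quartic_char_seven K)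
  have h0 := congrArg (eval 0) ha
  simp only [eval_add, eval_pow, eval_X, eval_sub, eval_C, zero_sub, eval_smul, smul_eq_mul] at h0
  norm_num at h0
  have ha0 : a = 0 := by
    have := (pow_eq_zero_iff (by norm_num : 4 ≠ 0)).mp h0.symm
    exact neg_eq_zero.mp this
  subst ha0
  have h4 := congrArg (eval 4) ha
  simp only [eval_add, eval_pow, eval_X, map_zero, sub_zero, eval_smul, smul_eq_mul] at h4
  exact one_ne_zero (by linear_combination (-2 : K) * h4 + (7 : K) * h7 : (1 : K) = 0)

end Char7

/-- **Degree 4 over a field, complete answer**: CA₄ holds iff the characteristic is not 3, 5 or 7 (the bad primes for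
degree 4 are exactly 3, 5, 7 — De Jong–Draisma). [cite: CastryckLaterveerOunaies2012, Sec. 1] -/
theorem holdsInDegree_four_iff : HoldsInDegree K 4 ↔ ((3 : K) ≠ 0 ∧ (5 : K) ≠ 0 ∧ (7 : K) ≠ 0) := by
  constructor
  · intro h
    refine ⟨fun hq => ?_, fun hq => ?_, fun hq => ?_⟩
    · haveI : CharP K 3 := (CharP.charP_iff_prime_eq_zero Nat.prime_three).mpr hq
      exact not_holdsInDegree_four_of_char_three K h
    · haveI : CharP K 5 := (CharP.charP_iff_prime_eq_zero (by norm_num)).mpr hq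
      exact not_holdsInDegree_four_of_char_five K h
    · haveI : CharP K 7 := (CharP.charP_iff_prime_eq_zero (by norm_num)).mpr hq
      exact not_holdsInDegree_four_of_char_seven K h
  · rintro ⟨h3, h5, h7⟩
    exact holdsInDegree_four_of_ne K h3 h5 h7

end Literature.Algebra.Polynomial.CasasAlvero
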